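import Summits.AnomalousDissipation.AnomalousDissipation.Theses.TaylorCertificates

/-!
# Sketch — crux-ideate round 2, ideator 6, crux `TaylorCertificates.TaylorCertificatePair`
(stmt-AnomalousDissipation-13037)

The crux is REFUTED (cdisprove `Disproof.lean`, `¬ TaylorCertificatePair`, landing under
`Theorems/TaylorCertificatePair/Negative/*`).  This file types the statements behind the memo
`QUIET-POINT-BEAT.md` (this seat): the FLOOR-only Taylor residue `TaylorFloor` that every round-1 seat
recommended as the repaired crux is itself killed, pointwise, at any smooth QUIET EULER POINT of the
chosen force (`P (v·∇)v = f`), so the repaired crux silently needs an inviscid rigidity property of `f`.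

* `TaylorFloorFor f`      — FLOOR half of the crux for a fixed force `f` (Taylor class: band-limited test
                            fields of degree `N ≤ C ν^{-1/2}`, weight `-Θ ≤ θ₁ ≤ 0`).
* `TaylorFloor`           — `∃ f`, the round-1 residue; `taylorFloor_of_taylorCertificatePair` (proved).
* `IsQuietEulerPoint f v` — `v` smooth, div-free, mean-zero, and `(v·∇)v - f ⊥` every smooth div-free
                            mean-zero field (steady forced Euler, weak form; then `(f, v) = 0`).
* `QuietPointFloorFailure f v` — the ∀∃-shape of the kill (quantifier order of the crux respected).
* `QuietPointBeat`        — FIRST LEMMA of the memo: every quiet Euler point kills `TaylorFloorFor f`.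
* `not_taylorFloorFor_of_failure`, `taylorFloor_needs_coercivity` — the logic (proved).
-/

namespace Summit.AnomalousDissipation.AnomalousDissipation.Cruxes.TaylorCertificatePair.QuietPointBeat

open MeasureTheory
open Literature.Analysis.FunctionSpaces Literature.Analysis.FluidPDE
open Summit.AnomalousDissipation.AnomalousDissipation.Theses.TaylorCertificates

/-- FLOOR half of `TaylorCertificatePair` for a FIXED force `f` (everything else verbatim). -/
def TaylorFloorFor (f : UnitAddTorus (Fin 3) → EuclideanSpace ℝ (Fin 3)) : Prop :=
  ∃ (ε₀ C Θ ν₀ : ℝ), 0 < ε₀ ∧ 0 < ν₀ ∧ ∀ ν : ℝ, 0 < ν → ν < ν₀ →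
    ∃ (N : ℕ) (Φ₁ : Torus.CylindricalTest (Fin 3)) (θ₁ : ℝ),
      (N : ℝ) ≤ C * ν ^ (-(1 / 2 : ℝ)) ∧
      (∀ i, Torus.fourierTruncate N (Φ₁.g i) = Φ₁.g i) ∧ -Θ ≤ θ₁ ∧ θ₁ ≤ 0 ∧
      ∀ u : Torus.energySpace (Fin 3),
        let uf : UnitAddTorus (Fin 3) → EuclideanSpace ℝ (Fin 3) :=
          ((u : MeasureTheory.Lp (EuclideanSpace ℝ (Fin 3)) 2
            (MeasureTheory.volume : MeasureTheory.Measure (UnitAddTorus (Fin 3)))) :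
              UnitAddTorus (Fin 3) → EuclideanSpace ℝ (Fin 3));
        let D : ℝ := ν * (Torus.eGradNormSq uf).toReal;
        let P : ℝ := Torus.pairing (u : MeasureTheory.Lp (EuclideanSpace ℝ (Fin 3)) 2
            (MeasureTheory.volume : MeasureTheory.Measure (UnitAddTorus (Fin 3)))) f - D;
        Torus.eGradNormSq uf ≠ ⊤ → ‖u‖ ^ 2 ≤ 16 * (∫ x, ‖f x‖ ^ 2) / ν ^ 2 →
          ε₀ ≤ D + Torus.nsGeneratorPairing ν f u (Φ₁.grad u) + 2 * θ₁ * P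

/-- The round-1 residue (`TaylorFloor` of Lines/laminar-ray-invisible-beat.md, same statement). -/
def TaylorFloor : Prop :=
  ∃ f : UnitAddTorus (Fin 3) → EuclideanSpace ℝ (Fin 3),
    Torus.IsSmooth f ∧ Torus.IsDivFree f ∧ Torus.HasZeroMean f ∧ TaylorFloorFor f

/-- The refuted crux implies the residue (drop `Φ₂, θ₂, E` and the CEILING conjunct). -/
theorem taylorFloor_of_taylorCertificatePair : TaylorCertificatePair → TaylorFloor := by
  rintro ⟨f, hfs, hfd, hfz, ε₀, E, C, Θ, ν₀, hε₀, hν₀, h⟩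
  refine ⟨f, hfs, hfd, hfz, ε₀, C, Θ, ν₀, hε₀, hν₀, fun ν hν hνlt => ?_⟩
  obtain ⟨N, Φ₁, Φ₂, θ₁, θ₂, hN, hg₁, _hg₂, hθ₁, hθ₁', _hθ₂, _hθ₂', hu⟩ := h ν hν hνlt
  exact ⟨N, Φ₁, θ₁, hN, hg₁, hθ₁, hθ₁', fun u hfin hball => (hu u hfin hball).1⟩

/-- `v` is a smooth QUIET EULER POINT of the force `f`: a smooth divergence-free mean-zero steady weak
solution of the forced Euler equations `(v·∇)v + ∇p = f` (tested against smooth div-free mean-zero `w`).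
Then `(f, v) = 0` (test with `w = v`), the Navier–Stokes generator at `v` is `F_ν(v) = -νAv`, and `v`
does no work: a Dirac mass at `v` is an `O(ν)`-approximately stationary, quiet statistic. -/
def IsQuietEulerPoint (f v : UnitAddTorus (Fin 3) → EuclideanSpace ℝ (Fin 3)) : Prop :=
  Torus.IsSmooth v ∧ Torus.IsDivFree v ∧ Torus.HasZeroMean v ∧
    ∀ w : UnitAddTorus (Fin 3) → EuclideanSpace ℝ (Fin 3),
      Torus.IsSmooth w → Torus.IsDivFree w → Torus.HasZeroMean w →
        ∫ x, inner ℝ (Torus.convect v v x - f x) (w x) = 0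

/-- The ∀∃ shape of the kill at a quiet point (quantifier order of the crux respected: `ν₁` depends on
`f, v, ε₀, C, Θ` only; the violating state is built AFTER `N, Φ₁, θ₁` are given, as the crux's `∀ u` allows).
The witness of the memo is `u = v + t w`, `t² = O(ν)`, `w` two Taylor-unresolved shear waves beating at the
heaviest resolved coefficient of `Φ₁.grad v`. -/
def QuietPointFloorFailure (f v : UnitAddTorus (Fin 3) → EuclideanSpace ℝ (Fin 3)) : Prop :=
  ∀ (ε₀ C Θ : ℝ), 0 < ε₀ → ∃ ν₁ : ℝ, 0 < ν₁ ∧ ∀ ν : ℝ, 0 < ν → ν < ν₁ →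
    ∀ (N : ℕ) (Φ₁ : Torus.CylindricalTest (Fin 3)) (θ₁ : ℝ),
      (N : ℝ) ≤ C * ν ^ (-(1 / 2 : ℝ)) →
      (∀ i, Torus.fourierTruncate N (Φ₁.g i) = Φ₁.g i) → -Θ ≤ θ₁ → θ₁ ≤ 0 →
      ∃ u : Torus.energySpace (Fin 3),
        let uf : UnitAddTorus (Fin 3) → EuclideanSpace ℝ (Fin 3) :=
          ((u : MeasureTheory.Lp (EuclideanSpace ℝ (Fin 3)) 2
            (MeasureTheory.volume : MeasureTheory.Measure (UnitAddTorus (Fin 3)))) :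
              UnitAddTorus (Fin 3) → EuclideanSpace ℝ (Fin 3));
        let D : ℝ := ν * (Torus.eGradNormSq uf).toReal;
        let P : ℝ := Torus.pairing (u : MeasureTheory.Lp (EuclideanSpace ℝ (Fin 3)) 2
            (MeasureTheory.volume : MeasureTheory.Measure (UnitAddTorus (Fin 3)))) f - D;
        Torus.eGradNormSq uf ≠ ⊤ ∧ ‖u‖ ^ 2 ≤ 16 * (∫ x, ‖f x‖ ^ 2) / ν ^ 2 ∧
          D + Torus.nsGeneratorPairing ν f u (Φ₁.grad u) + 2 * θ₁ * P < ε₀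

/-- **FIRST LEMMA (quiet-point beat).** Every smooth quiet Euler point of `f` kills the Taylor FLOOR
certificate for `f`.  Paper proof (memo §2): at `v`, `⟨F(v), W⟩ = -ν(∇v, ∇W)` and `(f,v) = 0`, so FLOOR
forces `max_q |q|‖Ŵ(q)‖ ≥ (ε₀ + S - (1+2Θ)ν‖∇v‖²)/(4π²ν Σ_q|q|‖v̂(q)‖)` for `W = Φ₁.grad v` with slack
`S ≥ 0`; an invisible two-wave beat of energy `t² = 64√3πK_v·ν` at the maximising `q` lowers the generator
pairing by `≥ (π/(2√3)) t² · max_q |q|‖Ŵ(q)‖` against a ν-independent viscous price `≤ 4π²(1+2Θ)(3C+8)² t²`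
(`Negative.inertial_three`-type bookkeeping; cross terms with `v` vanish identically for a trigonometric
polynomial `v` and are `O(ν^∞)` for smooth `v` once the carrier sits `ν^{-1/4}` above the resolution). -/
def QuietPointBeat : Prop :=
  ∀ f v : UnitAddTorus (Fin 3) → EuclideanSpace ℝ (Fin 3),
    Torus.IsSmooth f → IsQuietEulerPoint f v → QuietPointFloorFailure f v

/-- Logic: a quiet-point failure refutes the FLOOR certificate for that force. -/
theorem not_taylorFloorFor_of_failure {f v : UnitAddTorus (Fin 3) → EuclideanSpace ℝ (Fin 3)}
    (hfail : QuietPointFloorFailure f v) : ¬ TaylorFloorFor f := by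
  rintro ⟨ε₀, C, Θ, ν₀, hε₀, hν₀, h⟩
  obtain ⟨ν₁, hν₁, hkill⟩ := hfail ε₀ C Θ hε₀
  set ν : ℝ := min ν₀ ν₁ / 2 with hνdef
  have hmin : 0 < min ν₀ ν₁ := lt_min hν₀ hν₁
  have hν : 0 < ν := by rw [hνdef]; linarith
  have hν₀' : ν < ν₀ := by
    rw [hνdef]; linarith [min_le_left ν₀ ν₁]
  have hν₁' : ν < ν₁ := by
    rw [hνdef]; linarith [min_le_right ν₀ ν₁]
  obtain ⟨N, Φ₁, θ₁, hN, hg, hθ, hθ', hu⟩ := h ν hν hν₀'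
  obtain ⟨u, hfin, hball, hlt⟩ := hkill ν hν hν₁' N Φ₁ θ₁ hN hg hθ hθ'
  have hle := hu u hfin hball
  exact absurd hle (not_le.mpr hlt)

/-- What the repaired FLOOR crux silently needs of its force: NO smooth quiet Euler point
("smooth pointwise Euler-coercivity", cf. summit card euler-coercive-force, restricted to Dirac masses). -/
def TaylorFloorNeedsCoercivity : Prop :=
  ∀ f : UnitAddTorus (Fin 3) → EuclideanSpace ℝ (Fin 3), Torus.IsSmooth f →
    TaylorFloorFor f → ∀ v, ¬ IsQuietEulerPoint f v

theorem taylorFloor_needs_coercivity (hQ : QuietPointBeat) : TaylorFloorNeedsCoercivity := by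
  intro f hf hfloor v hv
  exact not_taylorFloorFor_of_failure (hQ f v hf hv) hfloor

/-- Example generator of excluded forces (memo §3): for EVERY smooth div-free mean-zero `v` that is not a
steady Euler flow, the force `f_v := P (v·∇)v ≠ 0` has the quiet point `v`; typed here as the statement
that such an `f_v` exists for each `v` (Leray–Helmholtz projection of a smooth field on `T³`; provable-now
support, Fourier side). -/
def QuietForceOf : Prop :=
  ∀ v : UnitAddTorus (Fin 3) → EuclideanSpace ℝ (Fin 3),
    Torus.IsSmooth v → Torus.IsDivFree v → Torus.HasZeroMean v →
      ∃ f : UnitAddTorus (Fin 3) → EuclideanSpace ℝ (Fin 3),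
        Torus.IsSmooth f ∧ Torus.IsDivFree f ∧ Torus.HasZeroMean f ∧ IsQuietEulerPoint f v

end Summit.AnomalousDissipation.AnomalousDissipation.Cruxes.TaylorCertificatePair.QuietPointBeat
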